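import Literature.AnabelianGeometry.AbsoluteAnabelian.MonoidKummerModel
import Literature.AnabelianGeometry.AbsoluteAnabelian.MLFGaloisGroupification

/-!
# [AbsTopIII] Prop 3.2 (ii)(iii)(v): transport of Kummer theories along isomorphisms of pairs, and
# the Kummer theory of an arbitrary MLF-Galois `TM`-pair

S. Mochizuki, *Topics in absolute anabelian geometry III*, §3, Prop. 3.2 (ii), (iii), (v) pp. 71–72
(bib key `MochizukiAbsTopIII2015`; locators = kurims manuscript pages, lit key `paper:url-5493eb38cbb7`):
(ii) "functorial algorithms for constructing the Kummer maps `M^H_TM → H¹(H, μ_Ẑ(M_TM))`,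
`M_TM → lim_J H¹(J, μ_Ẑ(M_TM))`"; (iii) "an additive structure [hence … a topological field structure]
on the union with `{0}` of the group generated by the image of the Kummer map"; (v) "the functor
`𝔩𝔬𝔤_{T,T}` is isomorphic to the identity functor" — at the level of objects: the field of (iii)
recovers `k̄ ⊇ 𝒪_k̄^⊳` (`MonoidKummerTheory.RecoversClosure`, `MonoidKummerMaps.lean`).

`MonoidKummerModel.lean` (seat abc-iut-L4-t2 gen 2) CONSTRUCTED these for the MODEL pair
`(Π_k ↷ 𝒪_k̄^⊳)`: `ModelMLFGaloisData.kummerTheory`, `kummerTheory_recoversClosure`.  This file (seat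
abc-iut-L4-t2; cone rows AbsTopIII:Prop3.2(iii), AbsTopIII:Prop3.2(v) of plan/CONE-BOARD.tsv,
sub-DAG rows P32.iii.L12 / P32.v.L19) carries them to EVERY MLF-Galois `TM`-pair:

* `ContCohomologyData.transport`, `MonoidKummerTheory.transport e` — a Kummer theory on `(Π ↷ M)` and
  an isomorphism of pairs `e : (Π ↷ M) ⥲ (Π' ↷ M')` (Def. 3.1 (ii)) give a Kummer theory on
  `(Π' ↷ M')` (cohomology along `Π' ⥲ Π`, Kummer classes of `e_M⁻¹(m')`, the same field `F` with
  `addStr ∘ e_M⁻¹`); `RecoversClosure.transport` — recovering the closure is preserved;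
* **`exists_monoidKummerTheory_recoversClosure`** — for every MLF-Galois `TM`-pair `P` there are model
  data `(k, k̄, Π_k ↠ G_k)`, an isomorphism `e : (Π_k ↷ 𝒪_k̄^⊳) ⥲ P` and a Kummer theory `T` on `P`
  (continuous cohomology `H¹(H, Ẑ(1))`, Kummer maps, field `F = k̄`) such that `T.RecoversClosure`:
  the field recovers `k̄` with `M ≅ 𝒪_k̄^⊳ ⊆ k̄` — Prop. 3.2 (ii)(iii)(v) at the level of objects, for
  abstract pairs.

HONEST FRAMING.  What is kernel-proved is EXISTENCE-BY-TRANSPORT from the model: the field structure of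
(iii) is obtained here from a chosen model, not reconstructed group-theoretically from `(Π ↷ M)` — the
latter is the content of Cor. 1.10 (h) (Belyi cuspidalization), a FACT-policy input of campaign M
(sub-DAG row P32.iii.L12), and the FUNCTORIALITY of the algorithm (row P32.v.L18) is not asserted.
OUR kernel constructions; nothing here bears on [IUTchIII] Cor. 3.12; typed ≠ proved downstream.
-/

noncomputable section

universe u

namespace Literature.AnabelianGeometry.AbsoluteAnabelian

open _root_.ValuativeRel
open Literature.AnabelianGeometry.EtaleTheta (cyclotome)

/-! ### Transport of continuous-cohomology data along an isomorphism of topological groups -/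

namespace ContCohomologyData

variable {P Q : Type u} [Group P] [TopologicalSpace P] [Group Q] [TopologicalSpace Q]

/-- Pull-back of an open subgroup of `Q` along `e : P ≃ₜ* Q` is monotone.
[cite: MochizukiAbsTopIII2015, Proposition 3.2 (ii) p.71] -/
theorem comap_mono (e : P ≃ₜ* Q) {H J : OpenSubgroup Q} (h : J ≤ H) :
    J.comap e.toMonoidHom e.continuous ≤ H.comap e.toMonoidHom e.continuous :=
  fun _ hx => h hx

/-- **Transport of cohomology data** along an isomorphism of topological groups `e : Π ⥲ Π'`:
`H¹(H', μ) := H¹(e⁻¹(H'), μ)`, restrictions pulled back, `H²` unchanged.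
[cite: MochizukiAbsTopIII2015, Proposition 3.2 (ii) p.71] -/
def transport (coh : ContCohomologyData P) (e : P ≃ₜ* Q) : ContCohomologyData Q where
  H1 H := coh.H1 (H.comap e.toMonoidHom e.continuous)
  res h := coh.res (comap_mono e h)
  res_id _ := coh.res_id _
  res_comp h₁ h₂ := coh.res_comp (comap_mono e h₁) (comap_mono e h₂)
  H2 := coh.H2

/-- `H¹` of the transported data (definitional). [cite: MochizukiAbsTopIII2015, Proposition 3.2 (ii) p.71] -/
theorem transport_H1 (coh : ContCohomologyData P) (e : P ≃ₜ* Q) (H : OpenSubgroup Q) :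
    (coh.transport e).H1 H = coh.H1 (H.comap e.toMonoidHom e.continuous) := rfl

end ContCohomologyData

/-! ### Transport of a Kummer theory along an isomorphism of pairs -/

namespace GaloisMonoidPair

variable {P Q : GaloisMonoidPair.{u}}

/-- The open subgroup `Stab(m) ⊆ Π` of an element of the arithmetic data (open by Def 3.1 (i)/(ii)).
[cite: MochizukiAbsTopIII2015, Definition 3.1 (ii) p.67] -/
def stabilizerOpenSubgroup (P : GaloisMonoidPair.{u}) (m : P.M) : OpenSubgroup P.Pi :=
  ⟨MulAction.stabilizer P.Pi m, P.isOpen_stabilizer m⟩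

/-- Membership in `stabilizerOpenSubgroup`. [cite: MochizukiAbsTopIII2015, Definition 3.1 (ii) p.67] -/
@[simp] theorem mem_stabilizerOpenSubgroup (P : GaloisMonoidPair.{u}) (m : P.M) (g : P.Pi) :
    g ∈ P.stabilizerOpenSubgroup m ↔ g • m = m := Iff.rfl

/-- If `H' ⊆ Π'` fixes `m'`, then `e_Π⁻¹(H') ⊆ Π` fixes `e_M⁻¹(m')`.
[cite: MochizukiAbsTopIII2015, Definition 3.1 (ii) p.67] -/
theorem Iso.smul_symm_eq_of_mem_comap (e : GaloisMonoidPair.Iso P Q) {H : OpenSubgroup Q.Pi} {m : Q.M}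
    (hm : ∀ h : H, (h : Q.Pi) • m = m) (g : H.comap e.isoPi.toMonoidHom e.isoPi.continuous) :
    (g : P.Pi) • e.isoM.symm m = e.isoM.symm m := by
  apply e.isoM.injective
  rw [e.smul_comm, MulEquiv.apply_symm_apply]
  exact hm ⟨e.isoPi g, g.2⟩

end GaloisMonoidPair

namespace MonoidKummerTheory

variable {P Q : GaloisMonoidPair.{u}}

/-- The cyclotome is functorial in isomorphisms of monoids: `M ≃ M'` induces `μ_Ẑ(M) ≃ μ_Ẑ(M')`.
[cite: MochizukiAbsTopIII2015, Definition 3.1 (v) p.69] -/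
def cyclotomeCongr {M N : Type u} [CommMonoid M] [CommMonoid N] (f : M ≃* N) : cyclotome M ≃* cyclotome N :=
  MonoidHom.toMulEquiv (EtaleTheta.cyclotome.map (Units.map f.toMonoidHom))
    (EtaleTheta.cyclotome.map (Units.map f.symm.toMonoidHom))
    (by
      ext ζ n
      simp)
    (by
      ext ζ n
      simp)

/-- **Transport of a Kummer theory along an isomorphism of pairs** `e : (Π ↷ M) ⥲ (Π' ↷ M')`
(Def 3.1 (ii)): cohomology along `e_Π`, cyclotome identification along `e_M`, Kummer classes
`κ_{H'}(m') := κ_{e_Π⁻¹ H'}(e_M⁻¹ m')`, the same field `F` with `M' → F`, `m' ↦ addStr (e_M⁻¹ m')`.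
[cite: MochizukiAbsTopIII2015, Proposition 3.2 (ii) p.71] -/
def transport (T : MonoidKummerTheory P) (e : GaloisMonoidPair.Iso P Q) : MonoidKummerTheory Q where
  coh := T.coh.transport e.isoPi
  h2Iso := T.h2Iso
  muG := T.muG
  cycIso := (cyclotomeCongr e.isoM.symm).trans T.cycIso
  kummer H m := T.kummer (H.comap e.isoPi.toMonoidHom e.isoPi.continuous)
    ⟨e.isoM.symm m.1, fun g => e.smul_symm_eq_of_mem_comap m.2 g⟩
  kummer_mul H m m' := by
    refine Eq.trans ?_ (T.kummer_mul (H.comap e.isoPi.toMonoidHom e.isoPi.continuous)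
      ⟨e.isoM.symm m.1, fun g => e.smul_symm_eq_of_mem_comap m.2 g⟩
      ⟨e.isoM.symm m'.1, fun g => e.smul_symm_eq_of_mem_comap m'.2 g⟩)
    congr 1
    exact Subtype.ext (map_mul e.isoM.symm m.1 m'.1)
  kummer_res hJH m := T.kummer_res (ContCohomologyData.comap_mono e.isoPi hJH) _
  kummerLim m := Quot.mk _ ⟨Q.stabilizerOpenSubgroup m,
    T.kummer ((Q.stabilizerOpenSubgroup m).comap e.isoPi.toMonoidHom e.isoPi.continuous)
      ⟨e.isoM.symm m, fun g => e.smul_symm_eq_of_mem_comap (fun h => h.2) g⟩⟩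
  kummerLim_spec m H hm := by
    refine Quot.sound ⟨H, fun h hh => hm ⟨h, hh⟩, le_refl H, ?_⟩
    change T.coh.res _ (T.kummer _ _) = T.coh.res _ (T.kummer _ _)
    rw [T.kummer_res, T.kummer_res]
  F := T.F
  addStr := T.addStr.comp e.isoM.symm.toMonoidHom
  addStr_injective := T.addStr_injective.comp e.isoM.symm.injective
  addStr_ne_zero m := T.addStr_ne_zero _

/-- The field of the transported theory is the same field (definitional). [cite: MochizukiAbsTopIII2015, Proposition 3.2 (iii) p.72] -/
theorem transport_F (T : MonoidKummerTheory P) (e : GaloisMonoidPair.Iso P Q) : (T.transport e).F = T.F := rfl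

/-- `addStr` of the transported theory is `addStr ∘ e_M⁻¹`. [cite: MochizukiAbsTopIII2015, Proposition 3.2 (iii) p.72] -/
theorem transport_addStr_apply (T : MonoidKummerTheory P) (e : GaloisMonoidPair.Iso P Q) (m : Q.M) :
    (T.transport e).addStr m = T.addStr (e.isoM.symm m) := rfl

/-- The Kummer map of the transported theory at `H' ⊆ Π'` is the Kummer map at `e_Π⁻¹ H'` of `e_M⁻¹ m'`.
[cite: MochizukiAbsTopIII2015, Proposition 3.2 (ii) p.71] -/
theorem transport_kummer (T : MonoidKummerTheory P) (e : GaloisMonoidPair.Iso P Q) (H : OpenSubgroup Q.Pi)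
    (m : {m : Q.M // ∀ h : H, (h : Q.Pi) • m = m}) :
    (T.transport e).kummer H m = T.kummer (H.comap e.isoPi.toMonoidHom e.isoPi.continuous)
      ⟨e.isoM.symm m.1, fun g => e.smul_symm_eq_of_mem_comap m.2 g⟩ := rfl

/-- **Recovering the closure is preserved by transport**: if `T` recovers `k̄ ⊇ 𝒪_k̄^⊳` through
`j : M → k̄`, then `T.transport e` does through `j ∘ e_M⁻¹`.
[cite: MochizukiAbsTopIII2015, Proposition 3.2 (v) p.72] -/
theorem RecoversClosure.transport {C : MLFClosure.{u}} {T : MonoidKummerTheory P} {j : P.M → C.K}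
    (h : T.RecoversClosure C j) (e : GaloisMonoidPair.Iso P Q) :
    (T.transport e).RecoversClosure C (fun m => j (e.isoM.symm m)) := by
  obtain ⟨ε, hε, hrange⟩ := h
  refine ⟨ε, fun m => hε _, ?_⟩
  rw [← hrange]
  ext x
  constructor
  · rintro ⟨m, rfl⟩
    exact ⟨e.isoM.symm m, rfl⟩
  · rintro ⟨m, rfl⟩
    exact ⟨e.isoM m, show j (e.isoM.symm (e.isoM m)) = j m by rw [MulEquiv.symm_apply_apply]⟩

end MonoidKummerTheory

/-! ### Prop 3.2 (ii)(iii)(v) at the level of objects, for every MLF-Galois `TM`-pair -/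

/-- **Every MLF-Galois `TM`-pair carries a Kummer theory recovering the closure**: for `P ∈ 𝒞^MLF_TM`
there are model data `(k, k̄, Π_k ↠ G_k)`, an isomorphism `e : (Π_k ↷ 𝒪_k̄^⊳) ⥲ P` and a Kummer theory
`T` on `P` — cohomology `H¹(H, Ẑ(1))` of `k̄`, the Kummer maps of Prop 3.2 (ii), field `F = k̄`
(Prop 3.2 (iii)) — such that `T.RecoversClosure` (Prop 3.2 (v), objects): the field is `k̄` and `M`
maps onto `𝒪_k̄^⊳ ⊆ k̄` along `e⁻¹`.  (Transport of `ModelMLFGaloisData.kummerTheory`; see the module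
docstring for what is and is not asserted.) [cite: MochizukiAbsTopIII2015, Proposition 3.2 (v) p.72] -/
theorem exists_monoidKummerTheory_recoversClosure (P : GaloisMonoidPair.{0})
    (hP : IsMLFGaloisMonoidPair .TM P) :
    ∃ (C : MLFClosure.{0}) (D : ModelMLFGaloisData C.k C.K) (e : GaloisMonoidPair.Iso D.tmPair P)
      (T : MonoidKummerTheory P),
      T.RecoversClosure C (fun m => ((e.isoM.symm m : D.tmPair.M) : C.K)) := by
  obtain ⟨C, D, Q₀, hQ₀, ⟨e⟩⟩ := hP.exists_model
  have hQ' : D.tmPair = Q₀ := Option.some_injective _ (D.monoidPair_TM.symm.trans hQ₀)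
  subst hQ'
  exact ⟨C, D, e, (D.kummerTheory C).transport e, (D.kummerTheory_recoversClosure C).transport e⟩

/-- In particular **Prop 3.2 (ii)/(iii) are inhabited for every MLF-Galois `TM`-pair** (a Kummer theory
with its field structure exists). [cite: MochizukiAbsTopIII2015, Proposition 3.2 (ii) p.71] -/
theorem nonempty_monoidKummerTheory (P : GaloisMonoidPair.{0}) (hP : IsMLFGaloisMonoidPair .TM P) :
    Nonempty (MonoidKummerTheory P) := by
  obtain ⟨C, D, e, T, _⟩ := exists_monoidKummerTheory_recoversClosure P hP
  exact ⟨T⟩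

end Literature.AnabelianGeometry.AbsoluteAnabelian

end
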